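import Literature.RepresentationTheory.KonnoKonno2007.JunctionVacuumSectionSwap
import Literature.NumberTheory.Weil1964.ArchPlacePhaseHom
import Literature.NumberTheory.Weil1964.ArchPlaceUnitaryDiagonal
import Literature.NumberTheory.Weil1964.ArchUnitaryWeilHalf
import Literature.NumberTheory.Weil1964.ArchMetaplecticUnitarySplittingContinuity
import Literature.NumberTheory.Weil1964.ArchUnitaryWeilHalfQuotient
import Literature.MathematicalPhysics.QuantumLattice.GaugeGroupsProofs
import Literature.NumberTheory.AdelicBaseChange.AdeleNormLocal
import HarnessLib

/-!
# The phase map of Folland's archimedean section at sign-block compact elements is a realified unitary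
# ([Folland1989, Prop. (4.39)]: `μ(k) = det^{-1/2} ⊗ μ₀(k)` on the maximal compact; [Weil1964, Chap. III n° 37])

Topic `NumberTheory/Weil1964`; namespace `Literature.NumberTheory.Weil1964`.  KERNEL ONLY: proved theorems and one definition with a body
(`sigmaUnitary`, the block-diagonal unitary `diag(a_v)_v ∈ U(Σ_v R_v)`); 0 records, 0 named facts, 0 `sorry`.  Sequel of `ArchUnitaryWeilHalf`
(`archWeilSectionS`, `archUFormPi`, `archIdx`) and `ArchPlaceUnitaryDiagonal` (`UForm.placeDiag`).

* § 1 `reindexSp_realifySp : reindexSp ε (realifySp σ' U) = realifySp σ (reindexUnitary ε U)` (the tree's `reindexPhase_realify` at the level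
  of the symplectic groups).
* § 2 `sigmaUnitary a` and **`placeDiag_kV : placeDiag (fun v => kV (a v, b v)) = kV (sigmaUnitary a, sigmaUnitary b)`** — sign-block compact
  place components assemble to a sign-block compact element of `U(Σ P_v, Σ Q_v)`.
* § 3 `ι𝕎_kV_one : ι𝕎 (kV k, 1) = realifySp (dualPairι (k, 1))` (generic indices; `κ_inl_one` + `ι𝕎_κ`) and
  **`exists_proj_archWeilSectionS_eq_realifySp`**: if every sign-frame component of `g ∈ U(J)(E ⊗ ℝ)` is sign-block compact
  (`archUFormPi g v = kV (a_v, b_v)`), then `∃ u, proj (archWeilSectionS g) = realifySp u` — EXACTLY the hypothesis `hu` of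
  `MpS.apply_hermitePi_zero_of_proj_eq_realifySp` and of `GRConstruction.omega_archHalfOf_gaussian_tmul`
  (`GelbartRogawski1991/DoubledWeilRepresentationArchVacuum`: the explicit archimedean half of the `χ`-normalised doubled Weil representation
  acts on the doubled Gaussian by `η_t(k) · vac`), whose `sectionD` is `archWeilSectionS` at the doubled CM datum.  Lean note: the instance
  terms on the block index type `DPIdx (Σ …) (Σ …) Unit Empty` must be taken from the tree terms by unification — hence the generic § 3 lemma
  and `simp only`, not `rw`.
* § 4 `diagUnitary`, `scaleConj_diagonal`, **`archUFormPi_eq_kV_of_diagonal`**: a place component whose matrix `g_{w(v)}` is `diag(d)`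
  (`|d_j| = 1`) is sign-block compact, `archUFormPi g v = kV (diag(d|_{P_v}), diag(d|_{Q_v}))` — the hypothesis of § 3 for the diagonal
  elements `(t·1_𝕍) ⊕ 1_{−𝕍}` of the doubled group at which central types are read.

HC_CM is NOT proved here or anywhere in the tree.  References: G. B. Folland, *Harmonic Analysis in Phase Space* (1989), §4.2 Prop. (4.39)
[Folland1989]; A. Weil, Acta Math. 111 (1964), Chap. I n° 12, Chap. III n° 37 [Weil1964]; K. Konno, T. Konno, Kyushu J. Math. 61 (2007), §3.1
[KonnoKonno2007].  Provenance: pub-hodgecm2 cell, seat item6-p3 (gen 11).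
-/

set_option autoImplicit false

noncomputable section

namespace Literature.NumberTheory.Weil1964

open Literature.Analysis.SegalBargmann Literature.RepresentationTheory.HeisenbergGroup
open Literature.RepresentationTheory.KonnoKonno2007

variable {σ σ' : Type} [Fintype σ] [DecidableEq σ] [Fintype σ'] [DecidableEq σ']

/-- **reindexing a realified unitary**: `reindexSp ε (realifySp σ' U) = realifySp σ (U^ε)` (`reindexPhase_realify` at the level of the
symplectic groups). [cite: Weil1964, Chap. I n° 12, p. 160] -/
theorem reindexSp_realifySp (ε : σ ≃ σ') (U : Matrix.unitaryGroup σ' ℂ) :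
    reindexSp ε (realifySp σ' U) = realifySp σ (reindexUnitary ε U) := by
  apply Subtype.ext
  apply LinearEquiv.ext
  intro pq
  have h := congrFun (reindexPhase_realify ε U) pq
  rw [← coe_realifySp, ← coe_reindexSp] at h
  rw [← coe_realifySp] at h
  exact h


/-! ## §2. The block assembly of sign-block COMPACT place components is sign-block compact: `placeDiag (kV (a_v, b_v))_v = kV (diag a, diag b)` -/

section PlaceDiagCompact

open Literature.RepresentationTheory.KonnoKonno2007.RealDualPair

variable {o : Type} [Fintype o] [DecidableEq o] {P Q : o → Type} [∀ v, Fintype (P v)] [∀ v, DecidableEq (P v)]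
  [∀ v, Fintype (Q v)] [∀ v, DecidableEq (Q v)]

/-- the block-diagonal matrix of unitaries is unitary. [cite: Weil1964, Chap. III n° 37] -/
theorem blockDiagonal'_mem_unitaryGroup {R : o → Type} [∀ v, Fintype (R v)] [∀ v, DecidableEq (R v)]
    (a : ∀ v, Matrix.unitaryGroup (R v) ℂ) :
    Matrix.blockDiagonal' (fun v => (a v : Matrix (R v) (R v) ℂ)) ∈ Matrix.unitaryGroup (Σ v, R v) ℂ := by
  rw [Matrix.mem_unitaryGroup_iff, Matrix.star_eq_conjTranspose, Matrix.blockDiagonal'_conjTranspose,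
    ← Matrix.blockDiagonal'_mul, ← Matrix.blockDiagonal'_one]
  congr 1
  funext v
  rw [← Matrix.star_eq_conjTranspose]
  exact Matrix.mem_unitaryGroup_iff.1 (a v).2

/-- **the block-diagonal unitary** `diag(a_v)_v ∈ U(Σ_v R_v)`. [cite: Weil1964, Chap. III n° 37] -/
def sigmaUnitary {R : o → Type} [∀ v, Fintype (R v)] [∀ v, DecidableEq (R v)] (a : ∀ v, Matrix.unitaryGroup (R v) ℂ) :
    Matrix.unitaryGroup (Σ v, R v) ℂ :=
  ⟨Matrix.blockDiagonal' fun v => (a v : Matrix (R v) (R v) ℂ), blockDiagonal'_mem_unitaryGroup a⟩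

/-- entries of `sigmaUnitary`. [cite: Weil1964, Chap. III n° 37] -/
@[simp] theorem coe_sigmaUnitary {R : o → Type} [∀ v, Fintype (R v)] [∀ v, DecidableEq (R v)] (a : ∀ v, Matrix.unitaryGroup (R v) ℂ) :
    ((sigmaUnitary a : Matrix.unitaryGroup (Σ v, R v) ℂ) : Matrix (Σ v, R v) (Σ v, R v) ℂ) =
      Matrix.blockDiagonal' fun v => (a v : Matrix (R v) (R v) ℂ) := rfl

/-- **sign-block compact components assemble to a sign-block compact element**: `placeDiag (kV (a_v, b_v))_v = kV (diag a, diag b)`.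
[cite: Weil1964, Chap. III n° 37] -/
theorem placeDiag_kV (a : ∀ v, Matrix.unitaryGroup (P v) ℂ) (b : ∀ v, Matrix.unitaryGroup (Q v) ℂ) :
    UForm.placeDiag (fun v => UForm.kV (P v) (Q v) (a v, b v)) =
      UForm.kV (Σ v, P v) (Σ v, Q v) (sigmaUnitary a, sigmaUnitary b) := by
  apply Subtype.ext
  apply Units.ext
  rw [UForm.coe_placeDiag, UForm.coe_kV, coe_sigmaUnitary, coe_sigmaUnitary]
  ext i j
  obtain ⟨⟨v, k⟩, rfl⟩ := (Equiv.sigmaSumDistrib P Q).surjective i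
  obtain ⟨⟨w, k'⟩, rfl⟩ := (Equiv.sigmaSumDistrib P Q).surjective j
  by_cases h : v = w
  · subst h
    rw [placeDiagMatrix_apply_same, UForm.coe_kV]
    rcases k with p | q <;> rcases k' with p' | q' <;>
      simp [Equiv.sigmaSumDistrib, Matrix.fromBlocks, Matrix.blockDiagonal'_apply_eq]
  · rw [placeDiagMatrix_apply_ne _ h]
    rcases k with p | q <;> rcases k' with p' | q' <;>
      simp [Equiv.sigmaSumDistrib, Matrix.fromBlocks, Matrix.blockDiagonal'_apply_ne _ _ _ h]

end PlaceDiagCompact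


/-! ## §3a. `ι𝕎 (kV k, 1)` is the realified block unitary (generic indices) -/

section GenericKV

open Literature.RepresentationTheory.KonnoKonno2007.RealDualPair

variable {P Q R S : Type} [Fintype P] [DecidableEq P] [Fintype Q] [DecidableEq Q] [Fintype R] [DecidableEq R]
  [Fintype S] [DecidableEq S]

/-- `ι𝕎 (kV k, 1) = realifySp (dualPairι (k, 1))` (`κ_inl_one` + `ι𝕎_κ`). [cite: KonnoKonno2007, §3.1] -/
theorem ι𝕎_kV_one (k : KV P Q) :
    ι𝕎 P Q R S (UForm.kV P Q k, (1 : UForm R S)) = realifySp _ (dualPairι ((k, (1 : KV R S)) : DPK P Q R S)) := by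
  rw [← UnitaryWeil.κ_inl_one, ι𝕎_κ]

end GenericKV

/-! ## §3. The phase map of Folland's section at an element with sign-block COMPACT place components is a realified unitary -/

section SectionCompact

open scoped Classical
open Literature.RepresentationTheory.KonnoKonno2007.RealDualPair
open Literature.NumberTheory.Automorphic Literature.NumberTheory.Automorphic.UnitaryGroup
open NumberField NumberField.InfinitePlace

variable {F : Type} [Field F] [NumberField F] (E : Type) [Field E] [NumberField E] [Algebra F E] (c : E ≃ₐ[F] E)
  (N : ℕ) (hc : c ≠ 1)
  (wOf : {v : InfinitePlace F // v.IsReal} → {w : InfinitePlace E // w.IsComplex})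
  (hw : ∀ v, c • (wOf v).1 = (wOf v).1) (hover : ∀ v, (wOf v).1.comap (algebraMap F E) = v.1)
  (t₀ : Fin N → F) (ht0 : ∀ j, t₀ j ≠ 0) {T : Matrix (Fin N) (Fin N) F} (hTd : T = Matrix.diagonal t₀)
  {J : Matrix (Fin N) (Fin N) E} (hJ : J = T.map (algebraMap F E)) {δ : E} (hcδ : c δ = -δ) (hδ : δ ≠ 0)

/-- **unitary phase map at sign-block compact elements**: if every sign-frame component of `g ∈ U(J)(E ⊗ ℝ)` is sign-block compact,
`archUFormPi g v = kV (a_v, b_v)`, then the phase map of Folland's section at `g` is a realified unitary (namely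
`realifySp (reindexUnitary archIdx (dualPairι ((diag a, diag b), 1)))`) — the hypothesis `hu` of `MpS.apply_hermitePi_zero_of_proj_eq_realifySp` ∕
`omega_archHalfOf_gaussian_tmul`.
[cite: Folland1989, §4.2 Prop. (4.39)] [cite: Weil1964, Chap. III n° 37] -/
theorem exists_proj_archWeilSectionS_eq_realifySp (g : UnitaryGroup.arch F E c N J)
    (a : ∀ v, Matrix.unitaryGroup (PosIdx (signVec wOf t₀ δ v)) ℂ) (b : ∀ v, Matrix.unitaryGroup (NegIdx (signVec wOf t₀ δ v)) ℂ)
    (hg : ∀ v, archUFormPi E c N hc wOf hw hover t₀ ht0 hTd hJ hcδ hδ g v = UForm.kV _ _ (a v, b v)) :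
    ∃ u : Matrix.unitaryGroup (Fin N × {v : InfinitePlace F // v.IsReal}) ℂ,
      MpS.proj (archWeilSectionS E c N hc wOf hw hover t₀ ht0 hTd hJ hcδ hδ g) = realifySp _ u := by
  have hfun : archUFormPi E c N hc wOf hw hover t₀ ht0 hTd hJ hcδ hδ g = fun v => UForm.kV _ _ (a v, b v) := funext hg
  have h1 : MpS.proj (archWeilSectionS E c N hc wOf hw hover t₀ ht0 hTd hJ hcδ hδ g) =
      reindexSp (archIdx E N wOf t₀ (δ := δ)) (MpS.proj (UnitaryWeil.weilHomV _ _ Unit Empty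
        (UForm.placeDiag (archUFormPi E c N hc wOf hw hover t₀ ht0 hTd hJ hcδ hδ g)))) := rfl
  rw [h1, hfun, placeDiag_kV]
  simp only [UnitaryWeil.proj_weilHomV, ι𝕎_kV_one, reindexSp_realifySp]
  exact ⟨_, rfl⟩

end SectionCompact

/-! ## §4. Place components with DIAGONAL unitary matrix are sign-block compact: `archUFormPi g v = kV (diag d|_P, diag d|_Q)` -/

section DiagonalCompact

open scoped Classical
open Literature.RepresentationTheory.KonnoKonno2007.RealDualPair
open Literature.NumberTheory.Automorphic Literature.NumberTheory.Automorphic.UnitaryGroup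
open NumberField NumberField.InfinitePlace

/-- the diagonal unitary matrix with unit-modulus entries. [cite: BrockerTomDieck1985, IV (3.1)] -/
def diagUnitary {m : Type} [Fintype m] [DecidableEq m] (d : m → ℂ) (hd : ∀ i, ‖d i‖ = 1) : Matrix.unitaryGroup m ℂ :=
  ⟨Matrix.diagonal d, (Literature.MathematicalPhysics.QuantumLattice.diagonal_mem_unitaryGroup_iff d).2 hd⟩

/-- its matrix. [cite: BrockerTomDieck1985, IV (3.1)] -/
@[simp] theorem coe_diagUnitary {m : Type} [Fintype m] [DecidableEq m] (d : m → ℂ) (hd : ∀ i, ‖d i‖ = 1) :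
    ((diagUnitary d hd : Matrix.unitaryGroup m ℂ) : Matrix m m ℂ) = Matrix.diagonal d := rfl

/-- the sign-frame rescaling fixes diagonal matrices: `D · diag(d) · D⁻¹ = diag(d)`. [cite: Folland1989, §4.1 Prop. (4.18)] -/
theorem scaleConj_diagonal {m : Type} [Fintype m] [DecidableEq m] (D : m → ℝ) (hD : ∀ i, D i ≠ 0) (d : m → ℂ) :
    scaleConj D (Matrix.diagonal d) = Matrix.diagonal d := by
  ext i j
  rw [scaleConj_apply]
  by_cases h : i = j
  · subst h
    rw [Matrix.diagonal_apply_eq, mul_comm ((D i : ℂ)) (d i), mul_assoc,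
      mul_inv_cancel₀ (Complex.ofReal_ne_zero.2 (hD i)), mul_one]
  · rw [Matrix.diagonal_apply_ne _ h, mul_zero, zero_mul]

variable {F : Type} [Field F] [NumberField F] (E : Type) [Field E] [NumberField E] [Algebra F E] (c : E ≃ₐ[F] E)
  (N : ℕ) (hc : c ≠ 1)
  (wOf : {v : InfinitePlace F // v.IsReal} → {w : InfinitePlace E // w.IsComplex})
  (hw : ∀ v, c • (wOf v).1 = (wOf v).1) (hover : ∀ v, (wOf v).1.comap (algebraMap F E) = v.1)
  (t₀ : Fin N → F) (ht0 : ∀ j, t₀ j ≠ 0) {T : Matrix (Fin N) (Fin N) F} (hTd : T = Matrix.diagonal t₀)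
  {J : Matrix (Fin N) (Fin N) E} (hJ : J = T.map (algebraMap F E)) {δ : E} (hcδ : c δ = -δ) (hδ : δ ≠ 0)

/-- **diagonal place components are sign-block compact**: if the matrix of `g_{w(v)} ∈ U(J_{w(v)})(ℂ)` is `diag(d)` (then `|d_j| = 1`), the
`v`-component of `g` in the sign frame is `kV (diag(d|_{P_v}), diag(d|_{Q_v}))`.  With § 3 this gives the unitary phase map at every `g` all of
whose archimedean components are diagonal — e.g. the elements `(t·1_𝕍) ⊕ 1_{−𝕍}` of the doubled group at which the central type is read.
[cite: Folland1989, §4.2 Prop. (4.39)] [cite: KonnoKonno2007, §3.1] -/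
theorem archUFormPi_eq_kV_of_diagonal (g : UnitaryGroup.arch F E c N J) (v : {v : InfinitePlace F // v.IsReal}) (d : Fin N → ℂ)
    (hd : ∀ j, ‖d j‖ = 1)
    (hg : (((archAt F E c N J (wOf v) (hw v) hc g : archLocal E N J (wOf v)) : GL (Fin N) ℂ) : Matrix (Fin N) (Fin N) ℂ) =
      Matrix.diagonal d) :
    archUFormPi E c N hc wOf hw hover t₀ ht0 hTd hJ hcδ hδ g v =
      UForm.kV _ _ (diagUnitary (fun p : PosIdx (signVec wOf t₀ δ v) => d ((signSplit (signVec wOf t₀ δ v)).symm (Sum.inl p)))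
          (fun _ => hd _),
        diagUnitary (fun q : NegIdx (signVec wOf t₀ δ v) => d ((signSplit (signVec wOf t₀ δ v)).symm (Sum.inr q)))
          (fun _ => hd _)) := by
  apply Subtype.ext
  apply Units.ext
  rw [UForm.coe_kV, coe_diagUnitary, coe_diagUnitary, Matrix.fromBlocks_diagonal]
  show UnitaryBall.mat (archUFormPi E c N hc wOf hw hover t₀ ht0 hTd hJ hcδ hδ g v) = _
  rw [UnitaryBall.mat, archUFormPi_apply, coe_archUForm, archPart_archToAdelic, hg,
    scaleConj_diagonal _ (sqrtAbs_signVec_ne_zero hc hw hcδ hδ ht0 v), Matrix.reindex_apply, Matrix.submatrix_diagonal_equiv]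
  congr 1
  funext k
  rcases k with p | q <;> rfl

end DiagonalCompact

/-! ## §5. The vacuum coefficient of Folland's section at sign-block compact elements: `vac = ∏_v (det b_v)⁻¹` -/

section VacuumCompact

open scoped Classical
open Literature.RepresentationTheory.KonnoKonno2007.RealDualPair
open Literature.NumberTheory.Automorphic Literature.NumberTheory.Automorphic.UnitaryGroup
open NumberField NumberField.InfinitePlace

/-- the `d`-block of `g ⊗ 1₁ ∈ U(junction with U(1,0))` has the determinant of the `d`-block of `g`. [cite: KonnoKonno2007, §3.1 (3.1)] -/
theorem det_d_toBig_inl_one {α β : Type} [Fintype α] [DecidableEq α] [Fintype β] [DecidableEq β] (g : UForm α β) :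
    (UnitaryBall.d (toBig α β Unit Empty (g, 1))).det = (UnitaryBall.d g).det := by
  have h : UnitaryBall.d (toBig α β Unit Empty (g, 1)) = Matrix.reindex (junE₂ α β) (junE₂ α β) (UnitaryBall.d g) := by
    rw [UnitaryBall.d, UnitaryBall.mat, toBig_inl_one, UForm.coe_relabel]
    rfl
  rw [h, Matrix.reindex_apply, Matrix.det_submatrix_equiv_self]

/-- the `d`-block of a sign-block compact element `kV (a, b)` is `b`. [cite: Folland1989, §4.2 Prop. (4.39)] -/
theorem d_kV {α β : Type} [Fintype α] [DecidableEq α] [Fintype β] [DecidableEq β]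
    (k : Matrix.unitaryGroup α ℂ × Matrix.unitaryGroup β ℂ) :
    UnitaryBall.d (UForm.kV α β k) = (k.2 : Matrix β β ℂ) := by
  rw [UnitaryBall.d, UnitaryBall.mat, UForm.coe_kV, Matrix.toBlocks_fromBlocks₂₂]

variable {F : Type} [Field F] [NumberField F] (E : Type) [Field E] [NumberField E] [Algebra F E] (c : E ≃ₐ[F] E)
  (N : ℕ) (hc : c ≠ 1)
  (wOf : {v : InfinitePlace F // v.IsReal} → {w : InfinitePlace E // w.IsComplex})
  (hw : ∀ v, c • (wOf v).1 = (wOf v).1) (hover : ∀ v, (wOf v).1.comap (algebraMap F E) = v.1)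
  (t₀ : Fin N → F) (ht0 : ∀ j, t₀ j ≠ 0) {T : Matrix (Fin N) (Fin N) F} (hTd : T = Matrix.diagonal t₀)
  {J : Matrix (Fin N) (Fin N) E} (hJ : J = T.map (algebraMap F E)) {δ : E} (hcδ : c δ = -δ) (hδ : δ ≠ 0)

/-- **Folland's normalising constant at sign-block compact elements**: if `archUFormPi g v = kV (a_v, b_v)` for all `v`, then
`vac (archWeilSectionS g) = (∏_v det b_v)⁻¹` (`μ(k) k₀ = (det k₂)^{-1}…`: [Folland1989, Prop. (4.39)] in the `det^{-1/2}`-normalisation of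
[Paul1998, (1.2.2)]). [cite: Folland1989, §4.2 Prop. (4.39)] [cite: Paul1998, §1.2 (1.2.2)] -/
theorem vac_archWeilSectionS_of_kV (g : UnitaryGroup.arch F E c N J)
    (a : ∀ v, Matrix.unitaryGroup (PosIdx (signVec wOf t₀ δ v)) ℂ) (b : ∀ v, Matrix.unitaryGroup (NegIdx (signVec wOf t₀ δ v)) ℂ)
    (hg : ∀ v, archUFormPi E c N hc wOf hw hover t₀ ht0 hTd hJ hcδ hδ g v = UForm.kV _ _ (a v, b v)) :
    MpS.vac (archWeilSectionS E c N hc wOf hw hover t₀ ht0 hTd hJ hcδ hδ g) =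
      (∏ v, ((b v : Matrix.unitaryGroup (NegIdx (signVec wOf t₀ δ v)) ℂ) :
        Matrix (NegIdx (signVec wOf t₀ δ v)) (NegIdx (signVec wOf t₀ δ v)) ℂ).det)⁻¹ := by
  have hfun : archUFormPi E c N hc wOf hw hover t₀ ht0 hTd hJ hcδ hδ g = fun v => UForm.kV _ _ (a v, b v) := funext hg
  -- (the instance terms on the block index types differ syntactically between `vac_weilHomV` and the goal: `convert`, cf. A2)
  have h := UnitaryWeil.vac_weilHomV (P := Σ v, PosIdx (signVec wOf t₀ δ v)) (Q := Σ v, NegIdx (signVec wOf t₀ δ v)) (R := Unit)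
    (S := Empty) (UForm.placeDiag (archUFormPi E c N hc wOf hw hover t₀ ht0 hTd hJ hcδ hδ g))
  have hdet : (UnitaryBall.d (toBig _ _ Unit Empty
      (UForm.placeDiag (archUFormPi E c N hc wOf hw hover t₀ ht0 hTd hJ hcδ hδ g), 1))).det =
      ∏ v, ((b v : Matrix.unitaryGroup (NegIdx (signVec wOf t₀ δ v)) ℂ) :
        Matrix (NegIdx (signVec wOf t₀ δ v)) (NegIdx (signVec wOf t₀ δ v)) ℂ).det := by
    rw [hfun, placeDiag_kV, det_d_toBig_inl_one, d_kV, coe_sigmaUnitary, Literature.NumberTheory.AdelicBaseChange.det_blockDiagonal']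
  rw [hdet] at h
  rw [archWeilSectionS_apply, MpS.vac_reindex]
  convert h using 2

end VacuumCompact

end Literature.NumberTheory.Weil1964

end
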